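import Summits.BirchSwinnertonDyer.Rank1Residual.X11b.KolyvaginShaFiniteAtPrime
import Literature.NumberTheory.EllipticCurves.HeegnerPointsKolyvaginPrimaryExponentProofs
import HarnessLib

/-!
# `p^{2m} · Ш(E/K)[p^∞] = 0` AT ONE odd surjective prime `p`, `p^{m+1} ∤ y_K`, from the cite-only
# printed inputs AT `p` — the QUANTITATIVE (exponent-form) per-prime telescope

Cell `b2b-bsdres`, team x11b3 (N8/O2); seat x11b3-p2 GEN 36 ((P2-QUANT)), the quantitative
companion of `X11b/KolyvaginShaFiniteAtPrime` (p323190, (P2-PERPRIME)).  Summit-side THEOREM-ONLY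
file (no definition, no named fact, no `sorry`); `K : Type`; ONE generic odd prime `p` with
`ρ̄_{E,p}` onto.

HONEST FRAMING (binding): **plumbing — COMPOSITIONS of tree theorems, nothing discharged.**  The
per-prime telescope of record concludes "`Ш(E/K)[p^∞]` is finite".  The tree's descent behind it
(`KolyvaginDescent.HypothesesM`, Gross 1991 §10 modulo `p^M`) proves MORE, namely Kolyvagin's
annihilation `p^{2M₀} · S_{p^M}(E/K) ⊆ ℤ x` with `M₀` McCallum's `ord_p [E(K) : ℤ y_K]` (Lemma
5.1: *"`ord_p [E(K) : ℤ y_K] = max{M : y_K ∈ p^M E(K)}`"*), exported at one prime by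
`KolyvaginDescent.pow_smul_sha_primary_eq_zero_at_of_pointsM_of_reciprocityM`
(`HeegnerPointsKolyvaginPrimaryExponentProofs`, this seat).  THIS FILE composes it with the
labelled leaf (A′) at `p` (`KolyvaginAssembly.hpoints_at_of_perLevelChoice`, p321380) exactly as
p323190 does: for ONE odd prime `p` with `ρ̄_{E,p}` onto, `E` non-CM, `d_K ∉ {−3, −4}`, and every
`m` with `p^{m+1} ∤ y_K` in `E(K)` — **`p^{2m} · Ш(E/K)[p^∞] = 0`** ⟸ the SAME labelled inputs AT
`p` as p323190 ({`hrec`, `hCM`, `h53`, `hGZ`, `hγ`} + `hR`, or `hPT` in place of `hR`; `hGZ`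
supplied by Kodaira–Néron on (KN_p)).  This is the EXPONENT form of McCallum's printed
`ord_p #Ш(E/K) ≤ 2 ord_p [E(K) : ℤ y_K]` (§1 Theorem (Kolyvagin)); the ORDER form — the tree's named
fact `Kolyvagin1990_padicValNat_card_sha_le`, binder `hB` of `bsdp_of_classX11b_three_of_onTreeInputs`
— is NOT obtained here (it needs Kolyvagin's classes `τ_λ(M)`, `λ ∈ Λ^r` for all `r`: *Euler systems*
(1990) Thm. A; ICM 1990 §2), and nothing is claimed about it.  Every binder is the corresponding
binder of p323190 token for token; the only change is the conclusion, whose ∀-prefix gains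
`{m : ℕ} (_hm : ∀ Q, p ^ (m + 1) • Q ≠ P) (c : Ш(E/K))` and reads `(∃ j, p ^ j • c = 0) →
p ^ (2 * m) • c = 0`.  Cite-only labelled hypotheses, NOT Literature facts, NOT discharged;
nothing booked; no mark / label / count / tier moves.

## What is proved

* `KolyvaginAssembly.pow_smul_sha_primary_eq_zero_at_of_leafInputs_of_reciprocityM` — at `p`,
  `p^{m+1} ∤ y_K`: `p^{2m} Ш(E/K)[p^∞] = 0` ⟸ EXACTLY {`hrec`, `hCM`, `h53`, `hGZ`, `hγ`, `hR`} at
  `p` + `hN`.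
* `KolyvaginAssembly.pow_smul_sha_primary_eq_zero_at_of_leafInputs_of_poitouTate` — the same
  with (R)_M SUPPLIED modulo `hPT`: SIX labels.
* `KolyvaginAssembly.pow_smul_sha_primary_eq_zero_at_of_leafInputs_of_poitouTate_of_kodairaNeron`
  — on (KN_p), `hGZ` SUPPLIED by Kodaira–Néron at `p`: FIVE labels + (KN_p).

## References

* [McCallumLMS1991] W. G. McCallum, *Kolyvagin's work on Shafarevich–Tate groups*, LMS LNS 153
  (1991), §1 Theorem (Kolyvagin) (p. 296), Lemma 5.1 (p. 303), Prop. 2.2, §§4–5 (held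
  `book:editornd-l-functions-arithmetic`, PDF pp. 276–286).
* [GrossLMS1991] B. H. Gross, *Kolyvagin's work on modular elliptic curves*, same volume, Thm. 1.3
  (2), §§3–8, §10 (held, chunks 212–231).
* [Kolyvagin1990] V. A. Kolyvagin, *Euler systems*, Grothendieck Festschrift II (1990), Thm. A
  (cite only; acq-00132); Proc. ICM Kyoto 1990, vol. I, 429–436, §2 (read, galaxy).
* [GrossZagier1986] III (3.1); [SilvermanAEC2009] Thm. VII.6.1; [MilneADT2006] Ch. I Thm. 4.10(b).

presearch: quantitative per-prime telescope → `lean search 'pow_smul_sha_primary'` → none; McCallum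
§1 / Lemma 5.1 [corpus:book:editornd-l-functions-arithmetic pp. 296, 303]; galaxy "2 ord_p [E(K)"
→ Durham volume only; nothing minted.
-/

noncomputable section

open scoped Classical
open WeierstrassCurve Field NumberField IsDedekindDomain
open Literature.NumberTheory.EllipticCurves Literature.NumberTheory.GaloisRepresentations
open Literature.NumberTheory.EllipticCurves.RingClassField
open Literature.NumberTheory.EllipticCurves.ModularForms
open Literature.NumberTheory.DiophantineGeometry Literature.NumberTheory.DiophantineGeometry.TateAlgorithm

namespace Summit.BirchSwinnertonDyer.Rank1Residual.X11b.KolyvaginAssembly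

-- `K : Type`: the tree's ring-class class field theory is universe `0`.
variable {K : Type} [Field K] [NumberField K] {N : ℕ} {W : WeierstrassCurve ℚ}

/-- **`p^{2m} · Ш(E/K)[p^∞] = 0` at ONE odd prime `p` with `ρ̄_{E,p}` onto, for every `m` with
`p^{m+1} ∤ y_K` in `E(K)`, from the cite-only printed inputs AT `p`** (McCallum 1991 §1 Theorem
(Kolyvagin) — per prime — in EXPONENT form, Lemma 5.1; Gross 1991 Thm. 1.3 (2) along §§3–8 and
§10): the composition of `KolyvaginDescent.pow_smul_sha_primary_eq_zero_at_of_pointsM_of_reciprocityM`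
with `KolyvaginAssembly.hpoints_at_of_perLevelChoice`.  Binders = those of
`sha_primary_finite_at_of_leafInputs_of_reciprocityM` (p323190) VERBATIM; conclusion: for `E`
non-CM, `K` imaginary quadratic with `d_K ∉ {−3, −4}` and the Heegner hypothesis, `P` a
non-torsion Heegner point, `ρ̄_{E,p}` onto and every `m` with `p^{m+1} ∤ P` in `E(K)`
(`_hm`), every class of `Ш(E/K)[p^∞]` is killed by `p^{2m}`.  CONDITIONAL on EXACTLY {`hrec`,
`hCM`, `h53`, `hGZ`, `hγ`, `hR`} AT `p` + `hN`; cite-only, NOT facts, NOT discharged; nothing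
booked. [cite: McCallumLMS1991, §1 Theorem (Kolyvagin), Lemma 5.1, Prop. 2.2, §§4–5]
[cite: GrossLMS1991, Thm. 1.3 (2), §§3–8, §10] -/
theorem pow_smul_sha_primary_eq_zero_at_of_leafInputs_of_reciprocityM [NeZero N] [W.IsGloballyMinimal]
    {p : ℕ} (hp : p.Prime) (hp2 : p ≠ 2)
    (hN : ∀ [W.IsElliptic], N = W.conductorNorm ℤ)
    (hrec : heegnerPointOfConductor_one_galoisConj N W K)
    (hCM : ∀ [W.IsElliptic] (_hK : IsImaginaryQuadratic K) (_hH : SatisfiesHeegnerHypothesis N K)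
      (Dt : ModularParametrizationData W N) (β : ℤ) (ι : K →+* ℂ),
      (4 * N : ℤ) ∣ β ^ 2 - NumberField.discr K →
      ∀ {M : ℕ}, 1 ≤ M → ∀ (m : ℕ), Squarefree m →
      (∀ q ∈ m.primeFactors, IsKolyvaginPrime N W K p q ∧ FrobEqFrobInfty W K (p ^ M) q) →
      ∃ y : (W.baseChange (ringClassField K ι m)).toAffine.Point,
        WeierstrassCurve.Affine.Point.map (W' := W) (ringClassField K ι m).subtype.toRatAlgHom y =
          heegnerPointComplexOfConductor Dt (NumberField.discr K) β m)
    (h53 : ∀ [W.IsElliptic] (_hK : IsImaginaryQuadratic K) (_hH : SatisfiesHeegnerHypothesis N K)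
      (Dt : ModularParametrizationData W N) (β : ℤ) (ι : K →+* ℂ) {M : ℕ}
      (_hM : 1 ≤ M) {n : ℕ} (_hn : Squarefree n)
      (_hKol : ∀ q ∈ n.primeFactors, IsKolyvaginPrime N W K p q ∧ FrobEqFrobInfty W K (p ^ M) q)
      (d : (m : ℕ) → m ∣ n → KolyvaginHeegnerData Dt β ι m) (m : ℕ) (hm : m ∣ n)
      (τm : ringClassField K ι m ≃ₐ[ℚ] ringClassField K ι m),
      (∀ x : ringClassField K ι m, ((τm x : ringClassField K ι m) : ℂ) = starRingEnd ℂ x) →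
      ∃ σ' ∈ ringClassGal ι m, IsOfFinAddOrder
        (pointGalHom W (ringClassField K ι m) τm (d m hm).y -
          (-W.rootNumber) • pointGalHom W (ringClassField K ι m) σ' (d m hm).y))
    (hGZ : ∀ [W.IsElliptic] (_hK : IsImaginaryQuadratic K) (_hH : SatisfiesHeegnerHypothesis N K)
      (Dt : ModularParametrizationData W N) (β : ℤ) (ι : K →+* ℂ) {M : ℕ} (_hM : 1 ≤ M) {n : ℕ}
      (_hn : Squarefree n)
      (_hKol : ∀ q ∈ n.primeFactors, IsKolyvaginPrime N W K p q ∧ FrobEqFrobInfty W K (p ^ M) q)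
      (d : (m : ℕ) → m ∣ n → KolyvaginHeegnerData Dt β ι m),
      ∃ n' : ℤ, IsCoprime ((p ^ M : ℕ) : ℤ) n' ∧
        ∀ (m : ℕ) (hm : m ∣ n) (γ : ringClassField K ι m ≃ₐ[ℚ] ringClassField K ι m),
          γ ∈ ringClassGal ι m → ∀ v : HeightOneSpectrum (𝓞 K),
            ¬ (W.baseChange K).HasGoodReductionAt v →
            n' • pointsMap (W.baseChange K) (v.adicCompletion K)
                ((d m hm).toGeomPoints (pointGalHom W (ringClassField K ι m) γ (d m hm).y)) ∈
              E0Receptacle (W.baseChange K) v ∧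
            ∀ (ℓ : ℕ) (hℓ : ℓ ∈ m.primeFactors)
              (hle : ringClassField K ι (m / ℓ) ≤ ringClassField K ι m),
              n' • pointsMap (W.baseChange K) (v.adicCompletion K)
                  ((d m hm).toGeomPoints (pointGalHom W (ringClassField K ι m) γ
                    (WeierstrassCurve.Affine.Point.map (W' := W)
                      ((RingClassField.inclusion ι hle).restrictScalars ℚ)
                      (d (m / ℓ)
                        ((Nat.div_dvd_of_dvd (Nat.dvd_of_mem_primeFactors hℓ)).trans hm)).y))) ∈
                E0Receptacle (W.baseChange K) v)
    (hγ : ∀ [W.IsElliptic] (_hK : IsImaginaryQuadratic K) (_hH : SatisfiesHeegnerHypothesis N K)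
      (Dt : ModularParametrizationData W N) (β : ℤ) (ι : K →+* ℂ) {M : ℕ}
      (_hM : 1 ≤ M) {n : ℕ} (_hn : Squarefree n)
      (_hKol : ∀ q ∈ n.primeFactors, IsKolyvaginPrime N W K p q ∧ FrobEqFrobInfty W K (p ^ M) q)
      (d : (m : ℕ) → m ∣ n → KolyvaginHeegnerData Dt β ι m)
      (m : ℕ) (hm : m ∣ n) (ℓ : ℕ) (hℓ : ℓ ∈ m.primeFactors) [Fact ℓ.Prime]
      (hΔ : ¬ (ℓ : ℤ) ∣ minimalDiscriminantInt W) (φ₀ : absoluteGaloisGroup (ZMod ℓ)),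
      (∀ x : AlgebraicClosure (ZMod ℓ), φ₀ • x = x ^ ℓ) →
      ∀ (hle : ringClassField K ι (m / ℓ) ≤ ringClassField K ι m)
        (γ : ringClassField K ι m ≃ₐ[ℚ] ringClassField K ι m), γ ∈ ringClassGal ι m →
        geomReduction hΔ ((RatClosure.pointsEquiv (K := K) W).symm
            ((d m hm).toGeomPoints (pointGalHom W (ringClassField K ι m) γ (d m hm).y))) =
          φ₀ • geomReduction hΔ ((RatClosure.pointsEquiv (K := K) W).symm
            ((d m hm).toGeomPoints (pointGalHom W (ringClassField K ι m) γ
              (WeierstrassCurve.Affine.Point.map (W' := W)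
                ((RingClassField.inclusion ι hle).restrictScalars ℚ)
                (d (m / ℓ)
                  ((Nat.div_dvd_of_dvd (Nat.dvd_of_mem_primeFactors hℓ)).trans hm)).y)))))
    (hR : ∀ [W.IsElliptic] (_hE : ¬ W.HasCM) (_hK : IsImaginaryQuadratic K)
      (_hD : NumberField.discr K ≠ -3 ∧ NumberField.discr K ≠ -4)
      (_hH : SatisfiesHeegnerHypothesis N K)
      {P : (W.baseChange K).toAffine.Point} (_hP : IsHeegnerPoint N W K P)
      (_hnt : ¬ IsOfFinAddOrder P) (_hp2 : p ≠ 2)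
      (_hρ : W.HasSurjectiveModNGaloisRep p) {M : ℕ} (_hM : 1 ≤ M)
      {ℓ : ℕ} (hℓ : IsKolyvaginPrime N W K p ℓ), FrobEqFrobInfty W K (p ^ M) ℓ →
      ∃ (A : Type) (_ : AddCommGroup A)
        (e : geomTorsion (W.baseChange K) ((p ^ M : ℕ) : ℤ) →+
          geomTorsion (W.baseChange K) ((p ^ M : ℕ) : ℤ) →+ A),
        (∀ x, e x x = 0) ∧ (∀ x, (∀ y, e x y = 0) → x = 0) ∧
        ∀ s ∈ selmerGroup (W.baseChange K) ((p ^ M : ℕ) : ℤ),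
          ∀ c' : galH1Torsion (W.baseChange K) ((p ^ M : ℕ) : ℤ),
          (∀ v : HeightOneSpectrum (𝓞 K), (ℓ : 𝓞 K) ∉ v.asIdeal →
            c' ∈ selmerLocalKer (W.baseChange K) (v.adicCompletion K) ((p ^ M : ℕ) : ℤ)) →
          (∀ w : InfinitePlace K,
            c' ∈ selmerLocalKer (W.baseChange K) w.Completion ((p ^ M : ℕ) : ℤ)) →
          ∀ 𝔔 ∈ hℓ.place.primesAbove, ∀ F : Field.absoluteGaloisGroup K,
            IsArithFrobAt (𝓞 K) F 𝔔 →
            F ∈ torsionFixing (W.baseChange K) ((p ^ M : ℕ) : ℤ) →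
            ∀ σ ∈ 𝔔.inertia (Field.absoluteGaloisGroup K),
            e (h1Eval (W.baseChange K) ((p ^ M : ℕ) : ℤ) s F)
              (h1Eval (W.baseChange K) ((p ^ M : ℕ) : ℤ) c' σ) = 0) :
    ∀ [W.IsElliptic] (_hE : ¬ W.HasCM) (_hK : IsImaginaryQuadratic K)
      (_hD : NumberField.discr K ≠ -3 ∧ NumberField.discr K ≠ -4)
      (_hH : SatisfiesHeegnerHypothesis N K)
      {P : (W.baseChange K).toAffine.Point} (_hP : IsHeegnerPoint N W K P)
      (_hnt : ¬ IsOfFinAddOrder P) (_hρ : W.HasSurjectiveModNGaloisRep p) {m : ℕ}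
      (_hm : ∀ Q : (W.baseChange K).toAffine.Point, p ^ (m + 1) • Q ≠ P) (c : (W.baseChange K).sha),
      (∃ j : ℕ, p ^ j • c = 0) → p ^ (2 * m) • c = 0 := by
  intro _ hE hK hD hH P hP hnt hρ m hm
  exact KolyvaginDescent.pow_smul_sha_primary_eq_zero_at_of_pointsM_of_reciprocityM W hK hP hnt hp
    hp2 hρ hm (hpoints_at_of_perLevelChoice hN hK hD hH hP hp hp2 hρ hrec hCM h53 hGZ hγ)
    (@fun _ hM _ hℓ hℓM ↦ hR hE hK hD hH hP hnt hp2 hρ hM hℓ hℓM)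

/-- **The same with Kolyvagin reciprocity (R)_M at `p` SUPPLIED modulo the Poitou–Tate named
fact** (`KolyvaginReciprocity.kolyvaginReciprocityM_of_poitouTate` at `p`): the QUANTITATIVE
per-prime telescope.  For ONE odd prime `p` with `ρ̄_{E,p}` onto and every `m` with `p^{m+1} ∤ y_K`
in `E(K)`: `p^{2m} · Ш(E/K)[p^∞] = 0` ⟸ EXACTLY {`hPT` (existing named fact), `hrec`, `hCM`, `h53`,
`hGZ`, `hγ`} AT `p` + `hN` — the SIX labels of `sha_primary_finite_at_of_leafInputs_of_poitouTate`
(p323190) VERBATIM; cite-only, NOT discharged; nothing booked.  EXPONENT form only: the ORDER form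
`ord_p #Ш(E/K) ≤ 2 ord_p [E(K) : ℤ y_K]` (named fact `Kolyvagin1990_padicValNat_card_sha_le`) is
NOT obtained. [cite: McCallumLMS1991, §1 Theorem (Kolyvagin), Lemma 5.1, Prop. 2.2]
[cite: GrossLMS1991, Thm. 1.3 (2), §§3–8, §10] [cite: MilneADT2006, Ch. I Thm. 4.10(b)] -/
theorem pow_smul_sha_primary_eq_zero_at_of_leafInputs_of_poitouTate [NeZero N] [W.IsGloballyMinimal]
    {p : ℕ} (hp : p.Prime) (hp2 : p ≠ 2)
    (hPT : Literature.NumberTheory.GaloisCohomology.poitouTate_sum_localTatePairing_eq_zero K)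
    (hN : ∀ [W.IsElliptic], N = W.conductorNorm ℤ)
    (hrec : heegnerPointOfConductor_one_galoisConj N W K)
    (hCM : ∀ [W.IsElliptic] (_hK : IsImaginaryQuadratic K) (_hH : SatisfiesHeegnerHypothesis N K)
      (Dt : ModularParametrizationData W N) (β : ℤ) (ι : K →+* ℂ),
      (4 * N : ℤ) ∣ β ^ 2 - NumberField.discr K →
      ∀ {M : ℕ}, 1 ≤ M → ∀ (m : ℕ), Squarefree m →
      (∀ q ∈ m.primeFactors, IsKolyvaginPrime N W K p q ∧ FrobEqFrobInfty W K (p ^ M) q) →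
      ∃ y : (W.baseChange (ringClassField K ι m)).toAffine.Point,
        WeierstrassCurve.Affine.Point.map (W' := W) (ringClassField K ι m).subtype.toRatAlgHom y =
          heegnerPointComplexOfConductor Dt (NumberField.discr K) β m)
    (h53 : ∀ [W.IsElliptic] (_hK : IsImaginaryQuadratic K) (_hH : SatisfiesHeegnerHypothesis N K)
      (Dt : ModularParametrizationData W N) (β : ℤ) (ι : K →+* ℂ) {M : ℕ}
      (_hM : 1 ≤ M) {n : ℕ} (_hn : Squarefree n)
      (_hKol : ∀ q ∈ n.primeFactors, IsKolyvaginPrime N W K p q ∧ FrobEqFrobInfty W K (p ^ M) q)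
      (d : (m : ℕ) → m ∣ n → KolyvaginHeegnerData Dt β ι m) (m : ℕ) (hm : m ∣ n)
      (τm : ringClassField K ι m ≃ₐ[ℚ] ringClassField K ι m),
      (∀ x : ringClassField K ι m, ((τm x : ringClassField K ι m) : ℂ) = starRingEnd ℂ x) →
      ∃ σ' ∈ ringClassGal ι m, IsOfFinAddOrder
        (pointGalHom W (ringClassField K ι m) τm (d m hm).y -
          (-W.rootNumber) • pointGalHom W (ringClassField K ι m) σ' (d m hm).y))
    (hGZ : ∀ [W.IsElliptic] (_hK : IsImaginaryQuadratic K) (_hH : SatisfiesHeegnerHypothesis N K)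
      (Dt : ModularParametrizationData W N) (β : ℤ) (ι : K →+* ℂ) {M : ℕ} (_hM : 1 ≤ M) {n : ℕ}
      (_hn : Squarefree n)
      (_hKol : ∀ q ∈ n.primeFactors, IsKolyvaginPrime N W K p q ∧ FrobEqFrobInfty W K (p ^ M) q)
      (d : (m : ℕ) → m ∣ n → KolyvaginHeegnerData Dt β ι m),
      ∃ n' : ℤ, IsCoprime ((p ^ M : ℕ) : ℤ) n' ∧
        ∀ (m : ℕ) (hm : m ∣ n) (γ : ringClassField K ι m ≃ₐ[ℚ] ringClassField K ι m),
          γ ∈ ringClassGal ι m → ∀ v : HeightOneSpectrum (𝓞 K),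
            ¬ (W.baseChange K).HasGoodReductionAt v →
            n' • pointsMap (W.baseChange K) (v.adicCompletion K)
                ((d m hm).toGeomPoints (pointGalHom W (ringClassField K ι m) γ (d m hm).y)) ∈
              E0Receptacle (W.baseChange K) v ∧
            ∀ (ℓ : ℕ) (hℓ : ℓ ∈ m.primeFactors)
              (hle : ringClassField K ι (m / ℓ) ≤ ringClassField K ι m),
              n' • pointsMap (W.baseChange K) (v.adicCompletion K)
                  ((d m hm).toGeomPoints (pointGalHom W (ringClassField K ι m) γ
                    (WeierstrassCurve.Affine.Point.map (W' := W)
                      ((RingClassField.inclusion ι hle).restrictScalars ℚ)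
                      (d (m / ℓ)
                        ((Nat.div_dvd_of_dvd (Nat.dvd_of_mem_primeFactors hℓ)).trans hm)).y))) ∈
                E0Receptacle (W.baseChange K) v)
    (hγ : ∀ [W.IsElliptic] (_hK : IsImaginaryQuadratic K) (_hH : SatisfiesHeegnerHypothesis N K)
      (Dt : ModularParametrizationData W N) (β : ℤ) (ι : K →+* ℂ) {M : ℕ}
      (_hM : 1 ≤ M) {n : ℕ} (_hn : Squarefree n)
      (_hKol : ∀ q ∈ n.primeFactors, IsKolyvaginPrime N W K p q ∧ FrobEqFrobInfty W K (p ^ M) q)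
      (d : (m : ℕ) → m ∣ n → KolyvaginHeegnerData Dt β ι m)
      (m : ℕ) (hm : m ∣ n) (ℓ : ℕ) (hℓ : ℓ ∈ m.primeFactors) [Fact ℓ.Prime]
      (hΔ : ¬ (ℓ : ℤ) ∣ minimalDiscriminantInt W) (φ₀ : absoluteGaloisGroup (ZMod ℓ)),
      (∀ x : AlgebraicClosure (ZMod ℓ), φ₀ • x = x ^ ℓ) →
      ∀ (hle : ringClassField K ι (m / ℓ) ≤ ringClassField K ι m)
        (γ : ringClassField K ι m ≃ₐ[ℚ] ringClassField K ι m), γ ∈ ringClassGal ι m →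
        geomReduction hΔ ((RatClosure.pointsEquiv (K := K) W).symm
            ((d m hm).toGeomPoints (pointGalHom W (ringClassField K ι m) γ (d m hm).y))) =
          φ₀ • geomReduction hΔ ((RatClosure.pointsEquiv (K := K) W).symm
            ((d m hm).toGeomPoints (pointGalHom W (ringClassField K ι m) γ
              (WeierstrassCurve.Affine.Point.map (W' := W)
                ((RingClassField.inclusion ι hle).restrictScalars ℚ)
                (d (m / ℓ)
                  ((Nat.div_dvd_of_dvd (Nat.dvd_of_mem_primeFactors hℓ)).trans hm)).y))))) :
    ∀ [W.IsElliptic] (_hE : ¬ W.HasCM) (_hK : IsImaginaryQuadratic K)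
      (_hD : NumberField.discr K ≠ -3 ∧ NumberField.discr K ≠ -4)
      (_hH : SatisfiesHeegnerHypothesis N K)
      {P : (W.baseChange K).toAffine.Point} (_hP : IsHeegnerPoint N W K P)
      (_hnt : ¬ IsOfFinAddOrder P) (_hρ : W.HasSurjectiveModNGaloisRep p) {m : ℕ}
      (_hm : ∀ Q : (W.baseChange K).toAffine.Point, p ^ (m + 1) • Q ≠ P) (c : (W.baseChange K).sha),
      (∃ j : ℕ, p ^ j • c = 0) → p ^ (2 * m) • c = 0 := by
  intro _ hE hK hD hH P hP hnt hρ m hm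
  exact KolyvaginDescent.pow_smul_sha_primary_eq_zero_at_of_pointsM_of_reciprocityM W hK hP hnt hp
    hp2 hρ hm (hpoints_at_of_perLevelChoice hN hK hD hH hP hp hp2 hρ hrec hCM h53 hGZ hγ)
    (@fun _ hM _ hℓ hℓM ↦ KolyvaginReciprocity.kolyvaginReciprocityM_of_poitouTate N W K hPT hE hK
      hD hH hP hnt hp hp2 hρ hM hℓ hℓM)

/-- **`p^{2m} · Ш(E/K)[p^∞] = 0` at ONE odd surjective prime `p` from FIVE cite-only inputs on the
Kodaira–Néron sub-class AT `p`**: `pow_smul_sha_primary_eq_zero_at_of_leafInputs_of_poitouTate`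
with its binder `hGZ` ([GZ86 III (3.1)] at `p`) SUPPLIED by `KolyvaginHloc.hGZ_of_kodairaNeron`
(p319336) under `hKNm` (`p ∤ ord_v(Δ_min(E/K))` at every multiplicative `v`) and `hKNa` (`p ≠ 3`,
or no additive place of type IV / IV*) — binders of
`sha_primary_finite_at_of_leafInputs_of_poitouTate_of_kodairaNeron` (p323190) VERBATIM.
CONDITIONAL on EXACTLY {`hPT` (named fact), `hrec`, `hCM`, `h53`, `hγ`} AT `p` + `hN` + (KN_p);
cite-only, NOT discharged except `hGZ`; nothing booked; no mark.
[cite: GrossLMS1991, Thm. 1.3 (2), Prop. 6.2 (1), §10] [cite: SilvermanAEC2009, Thm. VII.6.1]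
[cite: McCallumLMS1991, §1 Theorem (Kolyvagin), Lemma 5.1] -/
theorem pow_smul_sha_primary_eq_zero_at_of_leafInputs_of_poitouTate_of_kodairaNeron [NeZero N]
    [W.IsGloballyMinimal] {p : ℕ} (hp : p.Prime) (hp2 : p ≠ 2)
    (hPT : Literature.NumberTheory.GaloisCohomology.poitouTate_sum_localTatePairing_eq_zero K)
    (hN : ∀ [W.IsElliptic], N = W.conductorNorm ℤ)
    (hrec : heegnerPointOfConductor_one_galoisConj N W K)
    (hCM : ∀ [W.IsElliptic] (_hK : IsImaginaryQuadratic K) (_hH : SatisfiesHeegnerHypothesis N K)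
      (Dt : ModularParametrizationData W N) (β : ℤ) (ι : K →+* ℂ),
      (4 * N : ℤ) ∣ β ^ 2 - NumberField.discr K →
      ∀ {M : ℕ}, 1 ≤ M → ∀ (m : ℕ), Squarefree m →
      (∀ q ∈ m.primeFactors, IsKolyvaginPrime N W K p q ∧ FrobEqFrobInfty W K (p ^ M) q) →
      ∃ y : (W.baseChange (ringClassField K ι m)).toAffine.Point,
        WeierstrassCurve.Affine.Point.map (W' := W) (ringClassField K ι m).subtype.toRatAlgHom y =
          heegnerPointComplexOfConductor Dt (NumberField.discr K) β m)
    (h53 : ∀ [W.IsElliptic] (_hK : IsImaginaryQuadratic K) (_hH : SatisfiesHeegnerHypothesis N K)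
      (Dt : ModularParametrizationData W N) (β : ℤ) (ι : K →+* ℂ) {M : ℕ}
      (_hM : 1 ≤ M) {n : ℕ} (_hn : Squarefree n)
      (_hKol : ∀ q ∈ n.primeFactors, IsKolyvaginPrime N W K p q ∧ FrobEqFrobInfty W K (p ^ M) q)
      (d : (m : ℕ) → m ∣ n → KolyvaginHeegnerData Dt β ι m) (m : ℕ) (hm : m ∣ n)
      (τm : ringClassField K ι m ≃ₐ[ℚ] ringClassField K ι m),
      (∀ x : ringClassField K ι m, ((τm x : ringClassField K ι m) : ℂ) = starRingEnd ℂ x) →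
      ∃ σ' ∈ ringClassGal ι m, IsOfFinAddOrder
        (pointGalHom W (ringClassField K ι m) τm (d m hm).y -
          (-W.rootNumber) • pointGalHom W (ringClassField K ι m) σ' (d m hm).y))
    (hKNm : ∀ [W.IsElliptic] (v : HeightOneSpectrum (𝓞 K)),
      (W.baseChange K).HasMultiplicativeReductionAt v →
        ¬ p ∣ (W.baseChange K).ordMinimalDiscriminant v)
    (hKNa : ∀ [W.IsElliptic] (v : HeightOneSpectrum (𝓞 K)),
      (W.baseChange K).HasAdditiveReductionAt v → p ≠ 3 ∨
        ((W.baseChange K).kodairaSymbolAt v ≠ KodairaSymbol.IV ∧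
          (W.baseChange K).kodairaSymbolAt v ≠ KodairaSymbol.IVstar))
    (hγ : ∀ [W.IsElliptic] (_hK : IsImaginaryQuadratic K) (_hH : SatisfiesHeegnerHypothesis N K)
      (Dt : ModularParametrizationData W N) (β : ℤ) (ι : K →+* ℂ) {M : ℕ}
      (_hM : 1 ≤ M) {n : ℕ} (_hn : Squarefree n)
      (_hKol : ∀ q ∈ n.primeFactors, IsKolyvaginPrime N W K p q ∧ FrobEqFrobInfty W K (p ^ M) q)
      (d : (m : ℕ) → m ∣ n → KolyvaginHeegnerData Dt β ι m)
      (m : ℕ) (hm : m ∣ n) (ℓ : ℕ) (hℓ : ℓ ∈ m.primeFactors) [Fact ℓ.Prime]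
      (hΔ : ¬ (ℓ : ℤ) ∣ minimalDiscriminantInt W) (φ₀ : absoluteGaloisGroup (ZMod ℓ)),
      (∀ x : AlgebraicClosure (ZMod ℓ), φ₀ • x = x ^ ℓ) →
      ∀ (hle : ringClassField K ι (m / ℓ) ≤ ringClassField K ι m)
        (γ : ringClassField K ι m ≃ₐ[ℚ] ringClassField K ι m), γ ∈ ringClassGal ι m →
        geomReduction hΔ ((RatClosure.pointsEquiv (K := K) W).symm
            ((d m hm).toGeomPoints (pointGalHom W (ringClassField K ι m) γ (d m hm).y))) =
          φ₀ • geomReduction hΔ ((RatClosure.pointsEquiv (K := K) W).symm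
            ((d m hm).toGeomPoints (pointGalHom W (ringClassField K ι m) γ
              (WeierstrassCurve.Affine.Point.map (W' := W)
                ((RingClassField.inclusion ι hle).restrictScalars ℚ)
                (d (m / ℓ)
                  ((Nat.div_dvd_of_dvd (Nat.dvd_of_mem_primeFactors hℓ)).trans hm)).y))))) :
    ∀ [W.IsElliptic] (_hE : ¬ W.HasCM) (_hK : IsImaginaryQuadratic K)
      (_hD : NumberField.discr K ≠ -3 ∧ NumberField.discr K ≠ -4)
      (_hH : SatisfiesHeegnerHypothesis N K)
      {P : (W.baseChange K).toAffine.Point} (_hP : IsHeegnerPoint N W K P)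
      (_hnt : ¬ IsOfFinAddOrder P) (_hρ : W.HasSurjectiveModNGaloisRep p) {m : ℕ}
      (_hm : ∀ Q : (W.baseChange K).toAffine.Point, p ^ (m + 1) • Q ≠ P) (c : (W.baseChange K).sha),
      (∃ j : ℕ, p ^ j • c = 0) → p ^ (2 * m) • c = 0 :=
  pow_smul_sha_primary_eq_zero_at_of_leafInputs_of_poitouTate hp hp2 hPT hN hrec hCM h53
    (@fun _ hK _ Dt _ ι _ _ _ hn hKol d ↦
      KolyvaginHloc.hGZ_of_kodairaNeron hK ι Dt hp hp2 hn hKol d hKNm hKNa) hγ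

end Summit.BirchSwinnertonDyer.Rank1Residual.X11b.KolyvaginAssembly

end
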